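import Summits.Ventures.Crystal3D.Theorems.StickyWulffConstantTextureBuildHealedComposition
import HarnessLib

/-!
# TB-1: the healed composition WITH AN ADDITIVE DEFICIENCY ALLOWANCE — `6N' − b(x') ≤ 6N − b(x) + θ·N^{2/3}` costs the composition nothing
# (lane T, crux `TextureLiminfV5`, stmt-Ventures-23912; memo HOME/wulff-p2/g24/HEAL-g24.md §3 «insurance»)

HONEST FRAMING. Venture `Summits/Ventures/Crystal3D` (cell `crystal3d-full`), route `route-Ventures-StickyWulffConstant`, helper `--supports` the
law-v5 crux `TextureLiminfV5` (stmt-Ventures-23912).  Pure logic over '…TextureBuildHealedComposition' (census-free, standard axioms).  No cover is built;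
nothing is re-registered here (the registered v8.24 text `stub_TB_cover : CoverH BarlowAdhesionTCap` STANDS); F-C1 not moved.

WHY.  The healed binder `CoverH` (v8.24) asks the healed packing to satisfy `6N' − b(x') ≤ 6N − b(x)` exactly.  The healing toolkit ('…HealCut',
'…HealSurgery', '…HealFamily') delivers that whenever the removed junk's own half-defects pay the cut; for junk whose half-defects are not provably large
(memo §3) the constructor may want to pay a cut of `O(1)` per tall feature out of the slack instead.  This file records that the composition tolerates it for
free: an additive `θ·N^{2/3}` on the deficiency line is absorbed by running the cover at `θ/2`.

* `CoverHε Adh` — `CoverH` with `6N' − b(x') ≤ 6N − b(x) + θ·N^{2/3}`;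
* `coverHε_of_coverH` — the registered shape implies it (weakening);
* **`shadowTheoremSatAtomicV5_of_healedε₇_slack`**, `textureBuildHε₇_of_stubs`, `textureBuildHε₇_of_riserPackage` — the same three compositions as in
  '…HealedComposition', from `CoverHε` (cover instantiated at `θ/2`).
-/

noncomputable section

open scoped BigOperators InnerProductSpace
open MeasureTheory

namespace Summit.Ventures.Crystal3D.Cruxes.TextureLiminf.TexShadow

open Summit.Ventures.Crystal3D Summit.Ventures.Crystal3D.Theorems

/-- **THE HEALED BINDER WITH A DEFICIENCY ALLOWANCE**: as `CoverH`, but the healed packing may have deficiency up to `θ·N^{2/3}` MORE than the cluster. -/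
def CoverHε (Adh : Prop) : Prop :=
  BarlowResolution → Adh →
    ∀ C R₀ : ℝ, 1 ≤ R₀ → ∀ K δ θ : ℝ, 0 < δ → 0 < θ → ∃ N₀ : ℕ, ∀ N : ℕ, N₀ ≤ N → ∀ x : Fin N → E3, IsUnitPacking x →
      IsSaturated x → 6 * (N : ℝ) - (numContacts x : ℝ) ≤ K * (N : ℝ) ^ ((2 : ℝ) / 3) →
      ∃ (N' : ℕ) (x' : Fin N' → E3) (δ' : ℝ), (1 - δ) * (N : ℝ) ≤ (1 - δ') * (N' : ℝ) ∧
        6 * (N' : ℝ) - (numContacts x' : ℝ) ≤ 6 * (N : ℝ) - (numContacts x : ℝ) + θ * (N : ℝ) ^ ((2 : ℝ) / 3) ∧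
        ∃ (rc : RiseredCover C R₀ N' x') (μ : Mesh₇ rc δ'),
          rc.tilingLoss₂ + rc.rimSum + μ.gapCost ≤ θ * (N : ℝ) ^ ((2 : ℝ) / 3) + rc.unownedSlack₃

/-- The registered healed binder implies the one with allowance. -/
theorem coverHε_of_coverH {Adh : Prop} (h : CoverH Adh) : CoverHε Adh := by
  intro hres hadh C R₀ hR₀ K δ θ hδ hθ
  obtain ⟨N₀, hN₀⟩ := h hres hadh C R₀ hR₀ K δ θ hδ hθ
  refine ⟨N₀, fun N hN x hx hsat hK => ?_⟩
  obtain ⟨N', x', δ', hmass, hDef, rc, μ, hslack⟩ := hN₀ N hN x hx hsat hK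
  refine ⟨N', x', δ', hmass, ?_, rc, μ, hslack⟩
  have : 0 ≤ θ * (N : ℝ) ^ ((2 : ℝ) / 3) := mul_nonneg hθ.le (Real.rpow_nonneg (Nat.cast_nonneg N) _)
  linarith

/-- **THE LEVEL-2 COMPOSITION WITH HEALING AND ALLOWANCE**: `CoverHε` + the unchanged TB-energy binder + the wall law ⇒ the atomic-scale saturated shadow
theorem (cover run at `θ/2`: `energy ≤ Def(x') + θ/2·N^{2/3} ≤ Def(x) + θ·N^{2/3}`). -/
theorem shadowTheoremSatAtomicV5_of_healedε₇_slack {Adh : Prop} (hcover : CoverHε Adh)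
    (henergy : PolytopeCalculus → BarlowFreeCertificate →
      ∀ (C R₀ : ℝ), 1 ≤ R₀ → ∀ (N : ℕ) (x : Fin N → E3) (δ : ℝ) (rc : RiseredCover C R₀ N x) (μ : Mesh₇ rc δ),
        ∃ (n : ℕ) (G : Fin n → Set E3) (A : Fin n → (E3 ≃ₗᵢ[ℝ] E3)) (c : Fin n → Fin n → ℝ) (m : Fin n → Fin n → E3),
          IsTexture (13 / 25) (1 / 2) n G A c m ∧ (1 - δ) * (N : ℝ) ≤ Real.sqrt 2 * vol n G ∧
          energy n G A c m ≤ rc.tentBudget + rc.chargeSum + rc.riserSum + μ.gapCost) :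
    BarlowResolution → Adh → BilayerWallV5 → PolytopeCalculus → BarlowFreeCertificate → ShadowTheoremSatAtomicV5 := by
  intro hres hadh hBW hpoly hfree _hG _hC _hNRG _hSL K δ θ hδ hθ
  obtain ⟨C, R₀, hR₀, hW⟩ := hBW
  obtain ⟨N₀, hN₀⟩ := hcover hres hadh C R₀ hR₀ K δ (θ / 2) hδ (half_pos hθ)
  refine ⟨N₀, fun N hN x hx hsat hK => ?_⟩
  obtain ⟨N', x', δ', hmass', hDef', rc, μ, hslack⟩ := hN₀ N hN x hx hsat hK
  obtain ⟨n, G, A, c, m, hT, hvol, hEn⟩ := henergy hpoly hfree C R₀ hR₀ N' x' δ' rc μ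
  refine ⟨n, G, A, c, m, hT, hmass'.trans hvol, ?_⟩
  have hdisc := rc.tentBudget_add_chargeSum_le₃_slack hR₀ hW
  have hhalf : θ / 2 * (N : ℝ) ^ ((2 : ℝ) / 3) + θ / 2 * (N : ℝ) ^ ((2 : ℝ) / 3) = θ * (N : ℝ) ^ ((2 : ℝ) / 3) := by ring
  linarith

/-- **THE COMPOSITION OF RECORD WITH HEALING AND ALLOWANCE**: `CoverHε` + TB-energy ⇒ the registered shape of `stub_textureBuild`. -/
theorem textureBuildHε₇_of_stubs {Adh : Prop} (hcover : CoverHε Adh)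
    (henergy : PolytopeCalculus → BarlowFreeCertificate →
      ∀ (C R₀ : ℝ), 1 ≤ R₀ → ∀ (N : ℕ) (x : Fin N → E3) (δ : ℝ) (rc : RiseredCover C R₀ N x) (μ : Mesh₇ rc δ),
        ∃ (n : ℕ) (G : Fin n → Set E3) (A : Fin n → (E3 ≃ₗᵢ[ℝ] E3)) (c : Fin n → Fin n → ℝ) (m : Fin n → Fin n → E3),
          IsTexture (13 / 25) (1 / 2) n G A c m ∧ (1 - δ) * (N : ℝ) ≤ Real.sqrt 2 * vol n G ∧
          energy n G A c m ≤ rc.tentBudget + rc.chargeSum + rc.riserSum + μ.gapCost) :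
    BarlowResolution → Adh → BilayerWallV5 → PolytopeCalculus → BarlowFreeCertificate → ShadowTheoremSatV5 :=
  textureBuild_of_atomic (shadowTheoremSatAtomicV5_of_healedε₇_slack hcover henergy)

/-- **THE TB SUB-LINE BY NAME, HEALED FORM WITH ALLOWANCE**: `CoverHε` + T0 + the riser package ⇒ `ShadowTheoremSatV5`. -/
theorem textureBuildHε₇_of_riserPackage {Adh : Prop} (hcover : CoverHε Adh) (hT0 : BarlowFreeCertificateCover) (hB6 : RiserPackage₇) :
    BarlowResolution → Adh → BilayerWallV5 → PolytopeCalculus → BarlowFreeCertificate → ShadowTheoremSatV5 :=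
  textureBuildHε₇_of_stubs hcover (tb_energy_of_riserPackage₇ hT0 hB6)

end Summit.Ventures.Crystal3D.Cruxes.TextureLiminf.TexShadow

end
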